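/-
Copyright (c) 2026 the pub-hodgecm-mathlib formalisation cell (harness21).  Prover seat hodgecm-mathlib-K2Liu-p13 (g2), Track B «K2-LIT»,
#184♮ = hLiu418 = `stmt-HodgeConjecture-24832`; Road I v3 organ U1-CT-ind STAGE 2 (Q2), file F5-d (LEAD F0P6-plan (g14) 10:39:33Z ∕ 11:15:51Z «F4 → F5 → D-U1 stage 3 =»).
-/
import Summits.HodgeConjecture.HodgeConjecture.Theorems.K2LiuKlingenUnipotentAdelicDefs     -- ★ F4-1: `jAdelic`, `coe_adelicVal_jAdelic` (+ ★ F3′, F1)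
import HarnessLib

/-!
# Crux `HLiu418`, Road I v3, organ U1 stage 2 (Q2), file F5-d: THE KLINGEN-LEVI LAW OF THE IDENTITY CELL —
# `f(Ψ(m_Q(a,b)) · x) = χ_s(Ψ(m_Q(a,b))) · f(x)` for upper-triangular `b`, `det_Δ(Ψ(m_Q(a,b))) = a · b₀₀`

Cell `hodgecm-mathlib`, crux item hLiu418 = `stmt-HodgeConjecture-24832`; squad K2 ∕ K2Liu; LEAD F0P6-plan (g14), co-dealer K2E5-plan (g7); prover K2Liu-p13 (g2).
THEOREMS ONLY (no `def`, no instance, no notation, no named-fact hypothesis, no `sorry`); lane `--supports stmt-HodgeConjecture-24832 --as helper` (count-neutral).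
After ★ F5-b `tsum_cellOne_eq_tsum` the identity cell of the Q-constant term is `(∫β) · Σ_{[g′]} f(Ψ(m_Q(1, g′)) · h)`; this file is the section law of its inner function
`g′ ↦ f(Ψ(m_Q(1,g′)) h)` along E1's Borel of `U(J₂)`: for `a ∈ R^×` and `b ∈ U(J₂)(R)` UPPER TRIANGULAR the Klingen Levi letter `m_Q(a,b)` is itself upper triangular —
it lies in the Siegel parabolic — with `e₂`-block `diag(a, b₀₀)`:
* §0 (generic `R`) `blockTriangular_klingenLeviM_of_upper`, `det_toBlocks₁₁_klingenLeviM_of_upper` (`= a · b₀₀`);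
* §1 (`n = 2`, ★ F3 clauses BY VALUE, adelic letters) `isSiegelDelta_transport_klingenLevi_of_upper`, **`detDelta_transport_klingenLevi_of_upper`** (`det_Δ = a · b₀₀`: term 1 reads
  `χ(a b₀₀)‖a b₀₀‖^{s+1}`, i.e. E1's Borel parameter `s + ½` in `χ(b₀₀)‖b₀₀‖^{s′+½}` and the cuspidal exponent `‖a‖^{s+1}` of `E_Q`), **`apply_transport_klingenLevi_of_upper_mul`**
  (`f(Ψ(m_Q(a,b)) x) = siegelDeltaCharacter χ s (Ψ(m_Q(a,b))) · f x` for every Siegel section `f`).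
Twin of ★ F5-c `K2LiuKlingenInnerSectionLeviLaw` (term 2: `det_Δ(Ψ(ξ m ξ⁻¹)) = b₀₀ σ(a)⁻¹`, parameter `s − ½`).
[MoeglinWaldspurger1995, II.1.7], [Xiong2013, §4 Prop. 4.1], [GanTakeda2011SiegelWeil, §7.2 p. 23], [HarrisKudlaSweet1996, §1 (1.15)].
HONEST LABEL.  Count-neutral helper: `HC_CM` is proved only modulo the 7 printed citations (2 remaining named inputs: hLiu418 = `stmt-HodgeConjecture-24832`,
h413 = `stmt-HodgeConjecture-24833`) until rung 0 closes.
-/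

set_option autoImplicit false
set_option linter.dupNamespace false -- the mandated namespace repeats `HodgeConjecture.HodgeConjecture`

noncomputable section

open scoped Matrix
open NumberField IsDedekindDomain

namespace Summit.HodgeConjecture.HodgeConjecture.Cruxes.HLiu418.K2LiuKlingenCellOneLeviLaw

open Literature.NumberTheory.Automorphic Literature.NumberTheory.Automorphic.UnitaryGroup
open Literature.NumberTheory.GelbartRogawski1991 Literature.NumberTheory.GelbartRogawski1991.GRConstruction
open Literature.NumberTheory.GaloisRepresentations
open Literature.NumberTheory.K2Lit.SiegelDoubled
open Summit.HodgeConjecture.HodgeConjecture.Cruxes.HLiu418.K2LiuDoubledUTwoTwoBorelFrame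
open Summit.HodgeConjecture.HodgeConjecture.Cruxes.HLiu418.K2LiuKlingenParabolicDefs
open Summit.HodgeConjecture.HodgeConjecture.Cruxes.HLiu418.K2LiuKlingenUnipotentAdelicDefs
open Summit.HodgeConjecture.HodgeConjecture.Cruxes.HLiu418.K2LiuDoubledAntidiagonalTransportLevi (detDelta_transport_of_blockTriangular)
open Summit.HodgeConjecture.HodgeConjecture.Cruxes.HLiu418.K2LiuSiegelDoubledLeviMatrix (conjAdele_conjAdele')
open UnitaryDualPair

/-! ## §0 Generic algebra: `m_Q(a,b)` for upper-triangular `b` is upper triangular with `e₂`-block `diag(a, b₀₀)` -/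

section Generic

variable {R : Type*} [CommRing R] {σ : R →+* R}

/-- `m_Q(a,b)` is upper triangular when `b` is. [cite: Xiong2013, §4 Prop. 4.1] [cite: MoeglinWaldspurger1995, II.1.7] -/
theorem blockTriangular_klingenLeviM_of_upper (a : Rˣ) {b : unitaryGroupOfForm σ ((StdForm.antidiagonal 2).over R)}
    (hb : ((b : GL (Fin 2) R) : Matrix (Fin 2) (Fin 2) R) 1 0 = 0) : (klingenLeviM R σ a b).BlockTriangular id := by
  intro i j hij
  fin_cases i <;> fin_cases j <;> first | exact absurd hij (by decide) | simp [klingenLeviM, hb]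

/-- its `e₂`-reindexed upper-left block is `diag(a, b₀₀)`, of determinant `a · b₀₀`. [cite: Xiong2013, §4 Prop. 4.1] -/
theorem det_toBlocks₁₁_klingenLeviM (a : Rˣ) (b : unitaryGroupOfForm σ ((StdForm.antidiagonal 2).over R)) :
    ((Matrix.reindex (e₂ (n := 2)).symm (e₂ (n := 2)).symm (klingenLeviM R σ a b)).toBlocks₁₁).det =
      (a : R) * ((b : GL (Fin 2) R) : Matrix (Fin 2) (Fin 2) R) 0 0 := by
  have h11 : (Matrix.reindex (e₂ (n := 2)).symm (e₂ (n := 2)).symm (klingenLeviM R σ a b)).toBlocks₁₁ =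
      !![(a : R), 0; 0, ((b : GL (Fin 2) R) : Matrix (Fin 2) (Fin 2) R) 0 0] := by
    ext i j
    fin_cases i <;> fin_cases j <;> rfl
  rw [h11, Matrix.det_fin_two_of]
  ring

end Generic

/-! ## §1 Through the transport (`n = 2`) -/

variable {L : Type} [Field L] [NumberField L] [IsCMField L]
variable {N M : ℕ} {e : Fin N × Fin M ≃ Fin 2}
  {dV : Fin N → L} {hdV : ∀ i, IsCMField.complexConj L (dV i) = dV i}
  {dW : Fin M → L} {hdW : ∀ i, IsCMField.complexConj L (dW i) = dW i}

section Transport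

variable {SA : GL (Fin (2 + 2)) (AdeleRing (𝓞 L) L)}
  {Ψ : (quasiSplit (Fp L) L (IsCMField.complexConj L) (2 + 2)).Adelic ≃ₜ* HA L e dV hdV dW hdW} {X Y : Matrix (Fin 2) (Fin 2) (Fp L)} {a : Fp L}
  (hΨ : ∀ g : (quasiSplit (Fp L) L (IsCMField.complexConj L) (2 + 2)).Adelic,
    (((Ψ g : HA L e dV hdV dW hdW) : GL (Fin (2 + 2)) (AdeleRing (𝓞 L) L)) : Matrix (Fin (2 + 2)) (Fin (2 + 2)) (AdeleRing (𝓞 L) L)) =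
      (SA : Matrix (Fin (2 + 2)) (Fin (2 + 2)) (AdeleRing (𝓞 L) L)) *
        ((adelicVal (Fp L) L (IsCMField.complexConj L) (2 + 2) _ g : GL (Fin (2 + 2)) (AdeleRing (𝓞 L) L)) :
          Matrix (Fin (2 + 2)) (Fin (2 + 2)) (AdeleRing (𝓞 L) L)) *
        ((SA⁻¹ : GL (Fin (2 + 2)) (AdeleRing (𝓞 L) L)) : Matrix (Fin (2 + 2)) (Fin (2 + 2)) (AdeleRing (𝓞 L) L)))
  (ha : a + a = 1)
  (hSA : Matrix.reindex (e₂ (n := 2)).symm (e₂ (n := 2)).symm (SA : Matrix (Fin (2 + 2)) (Fin (2 + 2)) (AdeleRing (𝓞 L) L)) =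
    Matrix.fromBlocks (1 : Matrix (Fin 2) (Fin 2) (AdeleRing (𝓞 L) L)) (X.map ((algebraMap L (AdeleRing (𝓞 L) L)).comp (algebraMap (Fp L) L))) 1
      (-(X.map ((algebraMap L (AdeleRing (𝓞 L) L)).comp (algebraMap (Fp L) L)))))
  (hSAi : Matrix.reindex (e₂ (n := 2)).symm (e₂ (n := 2)).symm ((SA⁻¹ : GL (Fin (2 + 2)) (AdeleRing (𝓞 L) L)) : Matrix (Fin (2 + 2)) (Fin (2 + 2)) (AdeleRing (𝓞 L) L)) =
    Matrix.fromBlocks ((a • (1 : Matrix (Fin 2) (Fin 2) (Fp L))).map ((algebraMap L (AdeleRing (𝓞 L) L)).comp (algebraMap (Fp L) L)))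
      ((a • (1 : Matrix (Fin 2) (Fin 2) (Fp L))).map ((algebraMap L (AdeleRing (𝓞 L) L)).comp (algebraMap (Fp L) L)))
      (Y.map ((algebraMap L (AdeleRing (𝓞 L) L)).comp (algebraMap (Fp L) L)))
      (-(Y.map ((algebraMap L (AdeleRing (𝓞 L) L)).comp (algebraMap (Fp L) L)))))
  (hΨP : ∀ b : (quasiSplit (Fp L) L (IsCMField.complexConj L) (2 + 2)).Adelic,
    ((adelicVal (Fp L) L (IsCMField.complexConj L) (2 + 2) _ b : GL (Fin (2 + 2)) (AdeleRing (𝓞 L) L)) :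
        Matrix (Fin (2 + 2)) (Fin (2 + 2)) (AdeleRing (𝓞 L) L)).BlockTriangular id →
      IsSiegelDelta L e dV hdV dW hdW (Ψ b))

include hΨP in
/-- **`Ψ(m_Q(a,b)) ∈ P_Δ(𝔸)`** for `a ∈ 𝔸_L^×` and upper-triangular `b ∈ U(J₂)(𝔸)` (clause (T4)). [cite: Xiong2013, §4 Prop. 4.1] [cite: MoeglinWaldspurger1995, II.1.7] -/
theorem isSiegelDelta_transport_klingenLevi_of_upper (a' : (AdeleRing (𝓞 L) L)ˣ)
    {b : unitaryGroupOfForm (conjAdele (Fp L) L (IsCMField.complexConj L)) ((StdForm.antidiagonal 2).over (AdeleRing (𝓞 L) L))}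
    (hb : ((b : GL (Fin 2) (AdeleRing (𝓞 L) L)) : Matrix (Fin 2) (Fin 2) (AdeleRing (𝓞 L) L)) 1 0 = 0) :
    IsSiegelDelta L e dV hdV dW hdW (Ψ (jAdelic L 4
      (klingenLevi (AdeleRing (𝓞 L) L) (conjAdele (Fp L) L (IsCMField.complexConj L)) (conjAdele_conjAdele' L) a' b))) := by
  refine hΨP _ ?_
  rw [coe_adelicVal_jAdelic, coe_klingenLevi]
  exact blockTriangular_klingenLeviM_of_upper a' hb

include hΨ ha hSA hSAi in
/-- **`det_Δ(Ψ(m_Q(a,b))) = a · b₀₀`** for upper-triangular `b` (★ F3′): the identity-cell term of `E_Q` carries `χ(a b₀₀)‖a b₀₀‖^{s+1}` — cuspidal exponent `‖a‖^{s+1}` and E1's Borel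
parameter `s + ½`. [cite: Xiong2013, §4 Prop. 4.1] [cite: GanTakeda2011SiegelWeil, §7.2 p. 23] [cite: HarrisKudlaSweet1996, §1 (1.15)] -/
theorem detDelta_transport_klingenLevi_of_upper (a' : (AdeleRing (𝓞 L) L)ˣ)
    {b : unitaryGroupOfForm (conjAdele (Fp L) L (IsCMField.complexConj L)) ((StdForm.antidiagonal 2).over (AdeleRing (𝓞 L) L))}
    (hb : ((b : GL (Fin 2) (AdeleRing (𝓞 L) L)) : Matrix (Fin 2) (Fin 2) (AdeleRing (𝓞 L) L)) 1 0 = 0) :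
    detDelta L e dV hdV dW hdW (Ψ (jAdelic L 4
      (klingenLevi (AdeleRing (𝓞 L) L) (conjAdele (Fp L) L (IsCMField.complexConj L)) (conjAdele_conjAdele' L) a' b))) =
      (a' : AdeleRing (𝓞 L) L) * ((b : GL (Fin 2) (AdeleRing (𝓞 L) L)) : Matrix (Fin 2) (Fin 2) (AdeleRing (𝓞 L) L)) 0 0 := by
  rw [detDelta_transport_of_blockTriangular hΨ ha hSA hSAi
      (by rw [coe_adelicVal_jAdelic, coe_klingenLevi]; exact blockTriangular_klingenLeviM_of_upper a' hb),
    coe_adelicVal_jAdelic, coe_klingenLevi]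
  exact det_toBlocks₁₁_klingenLeviM a' b

include hΨP in
/-- **(Q2) F5-d — THE KLINGEN-LEVI LAW OF THE IDENTITY CELL**: `f(Ψ(m_Q(a,b)) · x) = siegelDeltaCharacter χ s (Ψ(m_Q(a,b))) · f(x)` for every Siegel section `f` of `I_Δ(s,χ)`,
`a ∈ 𝔸_L^×`, `b ∈ U(J₂)(𝔸)` upper triangular; with `detDelta_transport_klingenLevi_of_upper` the character value is `χ(a b₀₀)‖a b₀₀‖^{s+1}` — at `a = 1` the function
`g′ ↦ f(Ψ(m_Q(1,g′)) h)` is a BOREL SECTION of `U(J₂)(𝔸)` (E1's `U(Φ₂)`) at the parameter `s + ½`, so term 1 of `E_Q` is E1's Borel Eisenstein series of `i^*f` (file F5).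
[cite: MoeglinWaldspurger1995, II.1.7] [cite: Xiong2013, §4 Prop. 4.1] [cite: GanTakeda2011SiegelWeil, §7.2 p. 23] -/
theorem apply_transport_klingenLevi_of_upper_mul {χ : HeckeCharacter L} {s : ℂ} {f : HA L e dV hdV dW hdW → ℂ}
    (hf : IsSiegelDeltaSection L e dV hdV dW hdW χ s f) (a' : (AdeleRing (𝓞 L) L)ˣ)
    {b : unitaryGroupOfForm (conjAdele (Fp L) L (IsCMField.complexConj L)) ((StdForm.antidiagonal 2).over (AdeleRing (𝓞 L) L))}
    (hb : ((b : GL (Fin 2) (AdeleRing (𝓞 L) L)) : Matrix (Fin 2) (Fin 2) (AdeleRing (𝓞 L) L)) 1 0 = 0) (x : HA L e dV hdV dW hdW) :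
    f (Ψ (jAdelic L 4 (klingenLevi (AdeleRing (𝓞 L) L) (conjAdele (Fp L) L (IsCMField.complexConj L)) (conjAdele_conjAdele' L) a' b)) * x) =
      siegelDeltaCharacter L e dV hdV dW hdW χ s
          (Ψ (jAdelic L 4 (klingenLevi (AdeleRing (𝓞 L) L) (conjAdele (Fp L) L (IsCMField.complexConj L)) (conjAdele_conjAdele' L) a' b))) * f x :=
  hf _ (isSiegelDelta_transport_klingenLevi_of_upper hΨP a' hb) x

end Transport

end Summit.HodgeConjecture.HodgeConjecture.Cruxes.HLiu418.K2LiuKlingenCellOneLeviLaw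

end
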